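import Summits.Ventures.Crystal3D.Theorems.StickyWulffConstantStackingLiminfLayerSum
import Literature.MathematicalPhysics.StatisticalMechanics.BarlowStacking
import HarnessLib

/-!
# The full-lattice SKEW is `O(1/K)` (step S4(i) of stub (B) `stub_mollifiedUpper`, line `LayerChain` v4,
# crux `StackingLiminf`, stmt-Ventures-19145)

Route `StickyWulffConstant` of the venture `Summits/Ventures/Crystal3D` (cell `crystal3d-full`).
BLUEPRINT-v4B S4(i), conclusion: for a word `σ`, a point `y`, a finite set of layers `Kset` containing every
layer within height `K` of `y`, and per-layer finite index sets `G k` containing every site of layer `k`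
within lateral distance `K` of `y`, write `S_k(y) = Σ_{(i,j) ∈ G k} φ_K(y − barlowPos σ k i j)` (the
`K`-mollified density of the FULL layer `k` at `y`).  Then
`|Σ_{k ∈ Kset, σ k = −1} S_k(y) − window σ K (y₂) · Σ_{k ∈ Kset} S_k(y)| ≤ 2·#Kset·(2/√3)·12·bumpConst·(2(K+2))²/K⁴`
(**`abs_skewFull_le`**): the vacant-gap part of the full mollified density IS `f̄ = window σ K` times the
full density up to `O(#Kset/K²) = O(1/K)`.  Proof: each `S_k = (2/√3)·layerProf K (y₂ − kh) ± δ`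
(`layerSum_le/ge`), and `window σ K (y₂)` is exactly the ratio of the `σ k = −1` and the total
`layerProf` sums over the same layers (its finsums are supported in `Kset`), so the main terms cancel.
WHAT THIS IS NOT: not the skew bound for the OCCUPIED density (`E = V⁻ − f̄ v`, which adds the vacancy
term `|E| ≤ min(v, u + |E_full|)` and the pair count `…OccupiedVacantOverlap`), not stub (B); rung F-C1 not moved.
-/

noncomputable section

namespace Summit.Ventures.Crystal3D.Theorems.PlateauHeight

open MeasureTheory Set Function
open Literature.MathematicalPhysics.StatisticalMechanics (barlowPos haggLabel barlowStacking)
open Summit.Ventures.Crystal3D.Cruxes.StackingLiminf.LayerChainV4 (bump bumpConst layerProf window)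
open Summit.Ventures.Crystal3D.LayerChain (dot3)

/-- The bump at `y − barlowPos σ k i j` in layer form (lateral offsets `c₁ = L_k/2`, `c₂ = √3 L_k/6`,
height offset `y₂ − k h`). -/
theorem bump_sub_barlowPos_eq (σ : ℤ → ℤ) (K : ℝ) (y : Fin 3 → ℝ) (k i j : ℤ) :
    bump K (fun l => y l - (barlowPos 1 (Real.sqrt (2 / 3)) σ k i j) l) =
      bump K (![y 0 - ((i : ℝ) + j / 2 + haggLabel σ k / 2),
        y 1 - (Real.sqrt 3 / 2 * j + Real.sqrt 3 * haggLabel σ k / 6),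
        y 2 - k * Real.sqrt (2 / 3)] : Fin 3 → ℝ) := by
  congr 1
  ext l
  fin_cases l
  · simp
  · simp; ring
  · simp

/-- **The full-lattice skew is `O(#layers/K²)`.** -/
theorem abs_skewFull_le (σ : ℤ → ℤ) {K : ℝ} (hK : 1 ≤ K) (y : Fin 3 → ℝ) (Kset : Finset ℤ)
    (hKset : ∀ k : ℤ, |y 2 - k * Real.sqrt (2 / 3)| < K → k ∈ Kset) (G : ℤ → Finset (ℤ × ℤ))
    (hG : ∀ k ∈ Kset, ∀ i j : ℤ,
      Real.sqrt ((y 0 - ((i : ℝ) + j / 2 + haggLabel σ k / 2)) ^ 2 +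
        (y 1 - (Real.sqrt 3 / 2 * j + Real.sqrt 3 * haggLabel σ k / 6)) ^ 2) < K → (i, j) ∈ G k) :
    |(∑ k ∈ Kset.filter (fun k => σ k = -1), ∑ t ∈ G k,
        bump K (fun l => y l - (barlowPos 1 (Real.sqrt (2 / 3)) σ k t.1 t.2) l)) -
      window σ K (y 2) * ∑ k ∈ Kset, ∑ t ∈ G k,
        bump K (fun l => y l - (barlowPos 1 (Real.sqrt (2 / 3)) σ k t.1 t.2) l)| ≤
      2 * Kset.card * (2 / Real.sqrt 3 * (12 * bumpConst / K ^ 4 * ((2 * (K + 2)) * (2 * (K + 2))))) := by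
  classical
  have hK0 : 0 < K := by linarith
  have h3 : 0 < Real.sqrt 3 := Real.sqrt_pos.2 (by norm_num)
  have hb := bumpConst_pos
  set h : ℝ := Real.sqrt (2 / 3) with hh
  set δ : ℝ := 2 / Real.sqrt 3 * (12 * bumpConst / K ^ 4 * ((2 * (K + 2)) * (2 * (K + 2)))) with hδ
  set lp : ℤ → ℝ := fun k => layerProf K (y 2 - k * h) with hlp
  set S : ℤ → ℝ := fun k => ∑ t ∈ G k,
    bump K (fun l => y l - (barlowPos 1 (Real.sqrt (2 / 3)) σ k t.1 t.2) l) with hS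
  -- per-layer two-sided bound `|S k − (2/√3) lp k| ≤ δ` for `k ∈ Kset`
  have hlayer : ∀ k ∈ Kset, |S k - 2 / Real.sqrt 3 * lp k| ≤ δ := by
    intro k hk
    have eS : S k = ∑ t ∈ G k, bump K (![y 0 - ((t.1 : ℝ) + t.2 / 2 + haggLabel σ k / 2),
        y 1 - (Real.sqrt 3 / 2 * t.2 + Real.sqrt 3 * haggLabel σ k / 6), y 2 - k * h] : Fin 3 → ℝ) := by
      simp only [hS]
      exact Finset.sum_congr rfl fun t _ => bump_sub_barlowPos_eq σ K y k t.1 t.2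
    have hup := layerSum_le (haggLabel σ k / 2) (Real.sqrt 3 * haggLabel σ k / 6) hK (y 2 - k * h)
      (y 0, y 1) (G k)
    have hlo := layerSum_ge (haggLabel σ k / 2) (Real.sqrt 3 * haggLabel σ k / 6) hK (y 2 - k * h)
      (y 0, y 1) (G k) (fun i j hij => hG k hk i j hij)
    simp only at hup hlo
    rw [← eS] at hup hlo
    have hlp' : layerProf K (y 2 - k * h) = lp k := rfl
    rw [hlp'] at hup hlo
    have he : 12 * bumpConst / K ^ 4 * ((2 * K) * (2 * K)) ≤
        12 * bumpConst / K ^ 4 * ((2 * (K + 2)) * (2 * (K + 2))) :=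
      mul_le_mul_of_nonneg_left (by nlinarith) (by positivity)
    rw [abs_le]
    constructor
    · have : 2 / Real.sqrt 3 * (lp k - 12 * bumpConst / K ^ 4 * ((2 * (K + 2)) * (2 * (K + 2)))) ≤
          2 / Real.sqrt 3 * (lp k - 12 * bumpConst / K ^ 4 * ((2 * K) * (2 * K))) :=
        mul_le_mul_of_nonneg_left (by linarith) (by positivity)
      rw [hδ]; nlinarith
    · rw [hδ]; nlinarith
  -- the window as a ratio of finite sums over `Kset`
  have hsupp : (support fun k : ℤ => lp k) ⊆ ↑Kset := by
    intro k hk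
    rw [mem_support] at hk
    exact hKset k (by by_contra hc; rw [not_lt] at hc; exact hk (layerProf_eq_zero hK0 hc))
  have hsupp' : (support fun k : ℤ => if σ k = -1 then lp k else 0) ⊆ ↑Kset := by
    intro k hk
    rw [mem_support] at hk
    by_cases hσk : σ k = -1
    · rw [if_pos hσk] at hk; exact hsupp (mem_support.2 hk)
    · rw [if_neg hσk] at hk; exact absurd rfl hk
  set A : ℝ := ∑ k ∈ Kset.filter (fun k => σ k = -1), lp k with hA
  set B : ℝ := ∑ k ∈ Kset, lp k with hB
  have hwin : window σ K (y 2) = A / B := by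
    unfold window
    rw [finsum_eq_sum_of_support_subset _ hsupp', finsum_eq_sum_of_support_subset _ hsupp,
      Finset.sum_ite, Finset.sum_const_zero, add_zero]
  have hBpos : 0 < B := by
    have := finsum_layerProf_pos hK (y 2)
    rwa [finsum_eq_sum_of_support_subset _ hsupp] at this
  have hlp0 : ∀ k, 0 ≤ lp k := fun k => layerProf_nonneg hK0 _
  have hA0 : 0 ≤ A := Finset.sum_nonneg fun k _ => hlp0 k
  have hAB : A ≤ B := Finset.sum_le_sum_of_subset_of_nonneg (Finset.filter_subset _ _)
    fun k _ _ => hlp0 k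
  have hf0 : 0 ≤ A / B := div_nonneg hA0 hBpos.le
  have hf1 : A / B ≤ 1 := (div_le_one hBpos).2 hAB
  -- main terms cancel
  set Sm : ℝ := ∑ k ∈ Kset.filter (fun k => σ k = -1), S k with hSm
  set St : ℝ := ∑ k ∈ Kset, S k with hSt
  have hdev1 : |Sm - 2 / Real.sqrt 3 * A| ≤ Kset.card * δ := by
    rw [hSm, hA, Finset.mul_sum, ← Finset.sum_sub_distrib]
    calc |∑ k ∈ Kset.filter (fun k => σ k = -1), (S k - 2 / Real.sqrt 3 * lp k)|
        ≤ ∑ k ∈ Kset.filter (fun k => σ k = -1), |S k - 2 / Real.sqrt 3 * lp k| :=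
          Finset.abs_sum_le_sum_abs _ _
      _ ≤ ∑ k ∈ Kset.filter (fun k => σ k = -1), δ :=
          Finset.sum_le_sum fun k hk => hlayer k (Finset.mem_of_mem_filter k hk)
      _ = (Kset.filter (fun k => σ k = -1)).card * δ := by rw [Finset.sum_const, nsmul_eq_mul]
      _ ≤ Kset.card * δ := mul_le_mul_of_nonneg_right
          (by exact_mod_cast Finset.card_filter_le _ _) (by positivity)
  have hdev2 : |St - 2 / Real.sqrt 3 * B| ≤ Kset.card * δ := by
    rw [hSt, hB, Finset.mul_sum, ← Finset.sum_sub_distrib]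
    calc |∑ k ∈ Kset, (S k - 2 / Real.sqrt 3 * lp k)|
        ≤ ∑ k ∈ Kset, |S k - 2 / Real.sqrt 3 * lp k| := Finset.abs_sum_le_sum_abs _ _
      _ ≤ ∑ k ∈ Kset, δ := Finset.sum_le_sum fun k hk => hlayer k hk
      _ = Kset.card * δ := by rw [Finset.sum_const, nsmul_eq_mul]
  rw [hwin]
  have key : Sm - A / B * St = (Sm - 2 / Real.sqrt 3 * A) - A / B * (St - 2 / Real.sqrt 3 * B) := by
    field_simp
    ring
  rw [key]
  calc |(Sm - 2 / Real.sqrt 3 * A) - A / B * (St - 2 / Real.sqrt 3 * B)|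
      ≤ |Sm - 2 / Real.sqrt 3 * A| + |A / B * (St - 2 / Real.sqrt 3 * B)| := abs_sub _ _
    _ = |Sm - 2 / Real.sqrt 3 * A| + A / B * |St - 2 / Real.sqrt 3 * B| := by
        rw [abs_mul, abs_of_nonneg hf0]
    _ ≤ Kset.card * δ + 1 * (Kset.card * δ) := by
        gcongr
    _ = 2 * Kset.card * δ := by ring

end Summit.Ventures.Crystal3D.Theorems.PlateauHeight

end
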